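import Summits.Langlands.Langlands.Theses.AbelianSurfaceSerre
import Literature.NumberTheory.PAdicHodge.FontaineDpst
import Literature.NumberTheory.PAdicHodge.FontaineDpstUnconditional

/-!
# Disproof of `SerreGSp4Surjective` (stmt-Langlands-17765) — findings

Standing disprover's workfile (cdisprove gen 1, cycle 1, refuter-cdisprove-stmt-Langlands-17765-0,
2026-08-17). VERDICT: the crux is NOT refuted and is not refutable in the tree; it is a faithful
typing of an open conjecture (Serre's conjecture for `GSp₄/ℚ` in regular ORDINARY weight, level
prime to `p`, for `p ≥ p₀`, full image `GSp(J)(𝔽_p)`, multiplier `ε̄⁻¹`, residually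
`p`-distinguished ordinary shape — BCGP 2025 Lemma 10.4.1 hypothesis with Rem. 10.4.2), believed
TRUE (Herzig–Tilouine / Gee–Herzig–Savitt weight conjectures + Gee–Geraghty ordinary companions).

INDEX
* §0 `Clauses` — the crux split into `H1` (full symplectic image), `H2` (ordinary distinguished at
  `p`), `Concl`; `serreGSp4Surjective_iff` (`Iff.rfl`). Same bodies as the picked line's
  `Sketch.FullSymplecticImage / OrdinaryDistinguishedAt / RegularOrdinaryModular`.
* §1 checked structure of `H1`: `exists_range_iff_of_h1` — `H1` pins `range ρ̄ = GSp(J)(𝔽_p)`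
  EXACTLY (both inclusions), so no junk `ρ̄` (trivial, abelian, induced) passes `H1` for `p ≥ 3`;
  conversely NO `ρ̄` passing `H1` is constructible in the tree (inverse Galois problem for
  `GSp₄(𝔽_p)` — true via abelian surfaces + Serre's open image, unformalised). HENCE: no
  unconditional `¬ SerreGSp4Surjective` is typable, whatever the conclusion.
* §2 small models: at `p = 2` the hypothesis degenerates (`Jᵀ = -J` admits SYMMETRIC `J`, e.g.
  `J = 1`, and `(ZMod 2)ˣ = 1` so the multiplier clause is vacuous) — `h1_degenerate_at_two`,
  `units_zmod_two_subsingleton` (by `decide`). The guard `p₀ ≤ p` is therefore load-bearing for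
  MEANING; it cannot be turned into a kill of the `p₀ = 0` strengthening because the conclusion
  (`∃ π : CuspidalAutomorphicRepData …`) is irrefutable in the tree for every `ρ̄` (§3).
* §3 LOAD-BEARING ANALYSIS (paper verdicts, typed variants `SerreGSp4SurjectiveWithout…`):
  - `WithoutTriangular` (drop "ρ̄|Γ_{ℚ_p} triangularisable"): FALSE on paper — `Concl` gives an
    ordinary `r`, and `r` ordinary ⇒ `r̄|Γ_{ℚ_p}` has a full stable flag; any full-image `ρ̄` with
    `ρ̄|Γ_{ℚ_p}` ⊇ an irreducible niveau-2 block (superspecial abelian surface at `p`) is a witness.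
    LOAD-BEARING. Not formalisable (witness unconstructible; "ordinary ⇒ residually triangular"
    needs lattice reduction, absent).
  - `WithoutDistinct` (drop pairwise-distinct diagonal characters): plausibly STILL TRUE (Serre
    weight conjectures give ordinary modularity of non-`p`-distinguished ordinary `ρ̄` too, cf. GL₂:
    `ρ̄|G_p ∼ (χ *; 0 χ)` is ordinary-modular of weight `p`); needed by every ENGINE (Hida theory,
    BCGP lifting), not by truth. POSSIBLY UNNECESSARY.
  - `WithoutFullImage` (keep symplectic-`ε̄⁻¹`, drop surjectivity): for reducible Borel `ρ̄ = ⊕ ω^{bᵢ}`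
    it asks for CUSPIDAL `π` on GL₄ Eisenstein-congruent mod `p` at SOME level prime to `p` —
    plausible for all large `p` (level raising from Yoshida/SK lifts, Sorensen; GL₂ analogue = Mazur
    `N ≡ 1 mod p`), unproved; for irreducible small images it is sibling-route generality. NOT
    refutable; surjectivity is there for adequacy in lifting theorems.
  - `WithoutMultiplier` (image `= GSp(J)` with SOME multiplier): an EVEN multiplier makes `Concl`
    false on paper (automorphic symplectic `r` over ℚ are GSp₄-odd: Taylor/Weissauer,
    Bellaïche–Chenevier sign) — LOAD-BEARING as parity; the exact normalisation `ε̄⁻¹` (vs any odd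
    `χ`) is only a twist-normalisation (up to the non-square even characters).
  - `WithoutLargeP` (`p₀ = 0`): meaning degenerates at `p = 2` (§2); `p = 3`: fine as typed.
  None of these is typable as a CHECKED `_false_without_` theorem: every variant's conclusion is an
  `∃` over `CuspidalAutomorphicRepData 4 ℚ hcpt` + a Galois `r`, and the Galois clauses alone
  (`IsCrystallineOrdinaryOfShapeAt` with free `StrictMono a`, free `ν`, `red`) are satisfiable on
  paper for every `ρ̄` built from powers of `ε̄` (the only constructible ones), so non-existence
  always rests on CUSPIDALITY (Jacquet–Shalika), unformalised.
* §3b TIGHTNESS (paper, typed as the sorried near-miss `weightClass_forced`): any witness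
  `(π, r, a, ν)` of `Concl p ρ̄` for a `ρ̄` passing `H1` has `a 0 + a 3 = a 1 + a 2 =: w`,
  `w ≡ 1 (mod p-1)`, `ν = μ ε^{-w}` with `μ` finite-order, unramified at `p`, `μ̄ = 1`, `ν(c) = -1`;
  `a 0 mod (p-1)` is FREE (so `Concl(ρ̄) ⟺ ∃ c ∈ {0,(p-1)/2}`-twist of the printed "ρ̄ ≅ ρ̄_{π,p}").
  For the route's own type-A residuals `ρ̄ = A[p]^∨` (inertial exponents `(0,0,-1,-1)`), every
  witness has `a ≡ (c,c,c+1,c+1) mod (p-1)`: NO crystalline lift of Calabi–Yau shape `(0,1,2,3)`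
  exists for `p ≥ 5` — lines working "in weight `{0,1,2,3}`" must use POTENTIALLY crystalline
  lifts with a tame type at `p` (cards do) and come back through Hida theory at the end.
  Obstruction to checking: no tree lemma links `GaloisRep.cyclotomicCharacter (ℚ_v) p` on
  `absInertia` with `modPCyclotomicCharacterZMod ℚ p ∘ absGaloisRestrict`, nor gives an inertia
  element with `ε` of infinite order (flagged absent in `CrystallineOrdinaryShape`'s docstring).
* §4 `-- Targets` (line `Sketch`, PICKED 06:55Z, skeleton v2 registered 07:04Z, 7 stubs; v3 07:56Z;
  line declared DEAD by the lead 07:57Z, `Lines/Sketch-dead.md`): KILL of v2 stub 3/7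
  `stub_fontaineVoidBorel : FontaineVoidBorel 7` — `stub_fontaineVoidBorelV2_false` below (checked, 0
  sorries; LANDED as p147593 `Theorems/SerreGSp4Surjective/Negative/FontaineVoidBorelFalse.lean`, same
  proof, UNCONDITIONAL — no `FontaineDatumExists`): witness `r = 1`. Consequence: v2 `stub_levelOne_of`
  VACUOUS as decomposed. Defects: (1) weights only BOUNDED in `[0,3]` (needs "labelled HT weights exactly
  `{0,1,2,3}`"), (2) exponent SIGN (`ε̄⁻¹ ^ a i`): as typed the two conjuncts of the void's conclusion
  contradict each other at `ℓ = 7` (`{0,5,4,3}` vs `{0,1,2,3}` mod 6). Both repairs are in v3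
  (`IsResiduallyCyclotomicBorel` with inverse powers; `labelledHodgeTateWeightsAt … = {0,1,2,3}`); v3's
  engine is true in print (Fontaine 1993 Thm 1 at (7,3) + FL) and NOT attackable in-tree (no constructible
  `r` with verified labelled weights `{0,1,2,3}`: `IsCrystallineFramed`/weights of `⊕ ε^{-i}` are not
  derivable from the datum's specification), but it has NO consumer: the lead's D1 (Chenevier–Lannes Thm F:
  no level-one cuspidal algebraic `π` on `GL_n/ℚ` of motivic weight `0 < w < 11`; `7 ∤ p²+1`) makes the
  level-one `ℓ = 7` endgame certify only non-existence. Other stubs: `CoxeterOrderArith` TRUE (landed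
  p147171 by a prover); `RestrictionIsPolarized` TRUE (landed p147310); `BorelSkinnerWilesGSp4 7`
  consistent as typed, fires only vacuously at level one (D1), irrefutable in-tree (abs. irreducible
  hypothesis; `∃ π` conclusion); `LevelOneSerre`/`TameSliceSerre`/`WildSliceSerre` crux-like, irrefutable.
  NOTE kept for future lines: `LevelOneSerre`-type statements that include REDUCIBLE `ρ̄` and ask a
  CUSPIDAL `π` on GL₄ at free level are Eisenstein level-raising claims for every large `p` — not in print.
* §5 OVER-STRENGTH relative to the consumer (planner information, not a defect of truth): the support
  item `BCGPSerreReduction` (BCGP 2025 Lemma 10.4.1, p. 146) consumes Serre only at `ρ̄ = ρ̄_{A,p}` for ONE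
  prime `p` per surface, chosen in a density-one set; the crux quantifies over ALL full-image ordinary
  distinguished `ρ̄` for ALL `p ≥ p₀`. A restatement over "a set of primes of density one (or even
  infinitely many `p`) per compatible family" would serve the route equally and dodge the wild-at-2,3
  slice only if the surfaces' conductors allow (they do not in general: `A[p]` is ramified at every bad
  prime of `A` for `p ≫ 0`, so the wild slice is populated by surfaces with wild reduction at 2, 3 —
  Gee's F1/F2). Recorded in `Sketch-dead.md` item 3 as well.

WHY THE CRUX RESISTS (for provers): (i) both sides unconstructible/irrefutable in Lean today;
(ii) on paper every normalisation is consistent (m = 4 HLTT, HT ≥ 0 StrictMono, multiplier forced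
`ν̄ = ε̄⁻¹` by full image, weight class `w ≡ 1`, oddness) — the planner's cheapest falsifier (i)
passes; (iii) mathematically open, no counterexample family known; small `p` fenced by `p₀`.
-/

set_option linter.dupNamespace false

namespace Summit.Langlands.Langlands.Cruxes.SerreGSp4Surjective.Disproof

open Literature.NumberTheory.GaloisRepresentations Literature.NumberTheory.Automorphic
  Literature.NumberTheory.PAdicHodge
open scoped NumberField
open IsDedekindDomain Polynomial

noncomputable section

/-! ## §0 The crux's clauses, verbatim -/

section Clauses

variable (p : ℕ) [Fact p.Prime] (ρ : FramedGaloisRep ℚ (ZMod p) 4)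

/-- (H1): `ρ̄` preserves a non-degenerate alternating `J` up to `ε̄_p⁻¹` and its image is ALL of
`GSp(J)(𝔽_p)` (= `Sketch.FullSymplecticImage`). [folklore] -/
def H1 : Prop :=
  ∃ J : Matrix (Fin 4) (Fin 4) (ZMod p), J.transpose = -J ∧ IsUnit J.det ∧
    (∀ g : Field.absoluteGaloisGroup ℚ, (ρ g).val.transpose * J * (ρ g).val =
      (((modPCyclotomicCharacterZMod ℚ p g)⁻¹ : (ZMod p)ˣ) : ZMod p) • J) ∧
    ∀ M : GL (Fin 4) (ZMod p), (∃ c : ZMod p, IsUnit c ∧ M.val.transpose * J * M.val = c • J) →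
      M ∈ ρ.toMonoidHom.range

/-- (H2): at `v ∣ p`, `ρ̄|Γ_{ℚ_v}` is triangularisable over `𝔽̄_p` with pairwise distinct diagonal
characters (= `Sketch.OrdinaryDistinguishedAt`). [folklore] -/
def H2 : Prop :=
  ∀ v : HeightOneSpectrum (𝓞 ℚ), ((p : ℕ) : 𝓞 ℚ) ∈ v.asIdeal →
    ∃ g : GL (Fin 4) (AlgebraicClosure (ZMod p)),
      (∀ (τ : Field.absoluteGaloisGroup (v.adicCompletion ℚ)) (i j : Fin 4), j < i →
        (g.val * ((ρ.toLocal v τ).val.map (algebraMap (ZMod p) (AlgebraicClosure (ZMod p)))) *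
          (g⁻¹).val) i j = 0) ∧
      ∀ i j : Fin 4, i ≠ j → ∃ τ : Field.absoluteGaloisGroup (v.adicCompletion ℚ),
        (g.val * ((ρ.toLocal v τ).val.map (algebraMap (ZMod p) (AlgebraicClosure (ZMod p)))) *
            (g⁻¹).val) i i ≠
          (g.val * ((ρ.toLocal v τ).val.map (algebraMap (ZMod p) (AlgebraicClosure (ZMod p)))) *
            (g⁻¹).val) j j

/-- The "triangular" half of (H2) alone (for the mutation `WithoutDistinct`). [folklore] -/
def H2tri : Prop :=
  ∀ v : HeightOneSpectrum (𝓞 ℚ), ((p : ℕ) : 𝓞 ℚ) ∈ v.asIdeal →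
    ∃ g : GL (Fin 4) (AlgebraicClosure (ZMod p)),
      ∀ (τ : Field.absoluteGaloisGroup (v.adicCompletion ℚ)) (i j : Fin 4), j < i →
        (g.val * ((ρ.toLocal v τ).val.map (algebraMap (ZMod p) (AlgebraicClosure (ZMod p)))) *
          (g⁻¹).val) i j = 0

/-- The conclusion (= `Sketch.RegularOrdinaryModular`). [folklore] -/
def Concl : Prop :=
  ∃ (hcpt : isCompact_glFiniteIntegralLevel 4 ℚ) (π : CuspidalAutomorphicRepData 4 ℚ hcpt)
    (ι : PadicAlgCl p ≃+* ℂ) (r : FramedGaloisRep ℚ (PadicAlgCl p) 4),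
    π.1.IsRegularAlgebraic ∧
    (∀ v : HeightOneSpectrum (𝓞 ℚ), ((p : ℕ) : 𝓞 ℚ) ∈ v.asIdeal →
      π.1.IsUnramifiedAt v ∧ ∃ a : Fin 4 → ℕ, StrictMono a ∧ r.IsCrystallineOrdinaryOfShapeAt v a) ∧
    (∀ᶠ v : HeightOneSpectrum (𝓞 ℚ) in Filter.cofinite, ∃ a : Multiset ℂ,
      π.1.HasSatakeParamAt v a ∧ r.IsUnramifiedAt v ∧
        r.HasFrobCharpolyAt v (arithFrobPolyOfSatake ι v.residueCard 4 a)) ∧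
    (∃ ν : Field.absoluteGaloisGroup ℚ → PadicAlgCl p, r.IsSymplecticWithMultiplierFun ν) ∧
    ∃ red : (Valued.v : Valuation (PadicAlgCl p) NNReal).valuationSubring →+*
        AlgebraicClosure (ZMod p),
      ∀ g : Field.absoluteGaloisGroup ℚ,
        ∃ P : Polynomial (Valued.v : Valuation (PadicAlgCl p) NNReal).valuationSubring,
          P.map (Valued.v : Valuation (PadicAlgCl p) NNReal).valuationSubring.subtype =
              FramedRep.charpoly r g ∧
            P.map red = (FramedRep.charpoly ρ g).map (algebraMap (ZMod p) (AlgebraicClosure (ZMod p)))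

end Clauses

/-- The crux is literally `∃ p₀, ∀ p ≥ p₀, ∀ ρ̄, H1 → H2 → Concl`. [folklore] -/
theorem serreGSp4Surjective_iff :
    Summit.Langlands.Langlands.Theses.AbelianSurfaceSerre.SerreGSp4Surjective ↔
      ∃ p₀ : ℕ, ∀ (p : ℕ) [Fact p.Prime], p₀ ≤ p → ∀ ρ : FramedGaloisRep ℚ (ZMod p) 4,
        H1 p ρ → H2 p ρ → Concl p ρ :=
  Iff.rfl

/-! ## §1 Structure of (H1): the image is pinned exactly -/

/-- **(H1) pins the image**: under (H1), `M ∈ range ρ̄ ↔ M ∈ GSp(J)(𝔽_p)` (some unit multiplier).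
So (H1) excludes every constructible junk `ρ̄` for `p ≥ 3` (e.g. `-1 ∈ GSp(J)` is not in the range
of the trivial `ρ̄`), and conversely a `ρ̄` passing (H1) is a surjection `Γ_ℚ ↠ GSp₄(𝔽_p)` —
unconstructible in the tree. [folklore] -/
theorem exists_range_iff_of_h1 {p : ℕ} [Fact p.Prime] {ρ : FramedGaloisRep ℚ (ZMod p) 4}
    (h : H1 p ρ) :
    ∃ J : Matrix (Fin 4) (Fin 4) (ZMod p), J.transpose = -J ∧ IsUnit J.det ∧
      ∀ M : GL (Fin 4) (ZMod p),
        M ∈ ρ.toMonoidHom.range ↔ ∃ c : ZMod p, IsUnit c ∧ M.val.transpose * J * M.val = c • J := by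
  obtain ⟨J, hJt, hJu, hmul, himg⟩ := h
  refine ⟨J, hJt, hJu, fun M => ⟨?_, himg M⟩⟩
  rintro ⟨g, rfl⟩
  exact ⟨_, Units.isUnit _, hmul g⟩

/-! ## §2 Small models: the hypothesis degenerates at `p = 2` -/

/-- At `p = 2` the clause `Jᵀ = -J ∧ IsUnit J.det` admits the SYMMETRIC non-alternating `J = 1`
(so "`GSp(J)`" is an orthogonal group of order 48, not `Sp₄(𝔽₂) ≅ S₆`). [folklore] -/
theorem h1_degenerate_at_two :
    ∃ J : Matrix (Fin 4) (Fin 4) (ZMod 2), J.transpose = -J ∧ IsUnit J.det ∧ J 0 0 ≠ 0 :=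
  ⟨1, by decide, by rw [Matrix.det_one]; exact isUnit_one, by decide⟩

/-- At `p = 2` the multiplier clause is vacuous: `(ZMod 2)ˣ` is trivial, so `ε̄₂⁻¹ • J = J`. [folklore] -/
theorem units_zmod_two_subsingleton (u : (ZMod 2)ˣ) : u = 1 := by
  have : Subsingleton (ZMod 2)ˣ := by
    rw [← Fintype.card_le_one_iff_subsingleton, ZMod.card_units_eq_totient]
    decide
  exact Subsingleton.elim u 1

/-! ## §3 Load-bearing analysis (typed variants; verdicts in the module docstring) -/

section Variants

/-- The crux with the local TRIANGULARITY hypothesis dropped (H2 deleted entirely).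
Paper verdict: FALSE (ordinary `r` ⇒ residually triangular); LOAD-BEARING. [folklore] -/
def SerreGSp4SurjectiveWithoutTriangular : Prop :=
  ∃ p₀ : ℕ, ∀ (p : ℕ) [Fact p.Prime], p₀ ≤ p → ∀ ρ : FramedGaloisRep ℚ (ZMod p) 4,
    H1 p ρ → Concl p ρ

/-- The crux with DISTINCTNESS of the diagonal characters dropped (triangular kept).
Paper verdict: plausibly still TRUE; distinctness serves the engines. [folklore] -/
def SerreGSp4SurjectiveWithoutDistinct : Prop :=
  ∃ p₀ : ℕ, ∀ (p : ℕ) [Fact p.Prime], p₀ ≤ p → ∀ ρ : FramedGaloisRep ℚ (ZMod p) 4,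
    H1 p ρ → H2tri p ρ → Concl p ρ

/-- The crux with FULL IMAGE dropped (symplectic with multiplier `ε̄⁻¹` kept).
Paper verdict: unknown/plausible (Eisenstein level raising at free level); not refutable. [folklore] -/
def SerreGSp4SurjectiveWithoutFullImage : Prop :=
  ∃ p₀ : ℕ, ∀ (p : ℕ) [Fact p.Prime], p₀ ≤ p → ∀ ρ : FramedGaloisRep ℚ (ZMod p) 4,
    ρ.IsSymplecticWithMultiplierFun
        (fun g => (((modPCyclotomicCharacterZMod ℚ p g)⁻¹ : (ZMod p)ˣ) : ZMod p)) →
      H2 p ρ → Concl p ρ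

/-- The crux with the MULTIPLIER freed (image = `GSp(J)(𝔽_p)` for some `J`, any similitude).
Paper verdict: FALSE for even similitude characters (automorphic symplectic `r/ℚ` are odd);
parity LOAD-BEARING. [folklore] -/
def SerreGSp4SurjectiveWithoutMultiplier : Prop :=
  ∃ p₀ : ℕ, ∀ (p : ℕ) [Fact p.Prime], p₀ ≤ p → ∀ ρ : FramedGaloisRep ℚ (ZMod p) 4,
    (∃ J : Matrix (Fin 4) (Fin 4) (ZMod p), J.transpose = -J ∧ IsUnit J.det ∧
      ∀ M : GL (Fin 4) (ZMod p),
        M ∈ ρ.toMonoidHom.range ↔ ∃ c : ZMod p, IsUnit c ∧ M.val.transpose * J * M.val = c • J) →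
      H2 p ρ → Concl p ρ

/-- The crux for ALL primes (`p₀ = 0`). Paper verdict: meaning degenerates at `p = 2` (§2);
irrefutable in the tree. [folklore] -/
def SerreGSp4SurjectiveWithoutLargeP : Prop :=
  ∀ (p : ℕ) [Fact p.Prime], ∀ ρ : FramedGaloisRep ℚ (ZMod p) 4, H1 p ρ → H2 p ρ → Concl p ρ

/-- Sanity: each variant implies the crux (they are weakenings of the hypotheses). [folklore] -/
theorem serreGSp4Surjective_of_withoutTriangular (h : SerreGSp4SurjectiveWithoutTriangular) :
    Summit.Langlands.Langlands.Theses.AbelianSurfaceSerre.SerreGSp4Surjective := by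
  obtain ⟨p₀, h⟩ := h
  exact ⟨p₀, fun p _ hp ρ h1 _ => h p hp ρ h1⟩

/-- Sanity: `WithoutDistinct ⇒ crux`. [folklore] -/
theorem serreGSp4Surjective_of_withoutDistinct (h : SerreGSp4SurjectiveWithoutDistinct) :
    Summit.Langlands.Langlands.Theses.AbelianSurfaceSerre.SerreGSp4Surjective := by
  obtain ⟨p₀, h⟩ := h
  refine ⟨p₀, fun p _ hp ρ h1 h2 => h p hp ρ h1 fun v hv => ?_⟩
  obtain ⟨g, hg, -⟩ := h2 v hv
  exact ⟨g, hg⟩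

/-- Sanity: `WithoutFullImage ⇒ crux`. [folklore] -/
theorem serreGSp4Surjective_of_withoutFullImage (h : SerreGSp4SurjectiveWithoutFullImage) :
    Summit.Langlands.Langlands.Theses.AbelianSurfaceSerre.SerreGSp4Surjective := by
  obtain ⟨p₀, h⟩ := h
  refine ⟨p₀, fun p _ hp ρ h1 h2 => h p hp ρ ?_ h2⟩
  obtain ⟨J, hJt, hJu, hmul, -⟩ := h1
  exact ⟨J, hJt, hJu, hmul⟩

/-- Sanity: `WithoutMultiplier ⇒ crux` (via §1). [folklore] -/
theorem serreGSp4Surjective_of_withoutMultiplier (h : SerreGSp4SurjectiveWithoutMultiplier) :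
    Summit.Langlands.Langlands.Theses.AbelianSurfaceSerre.SerreGSp4Surjective := by
  obtain ⟨p₀, h⟩ := h
  exact ⟨p₀, fun p _ hp ρ h1 h2 => h p hp ρ (exists_range_iff_of_h1 h1) h2⟩

/-- Sanity: `WithoutLargeP ⇒ crux`. [folklore] -/
theorem serreGSp4Surjective_of_withoutLargeP (h : SerreGSp4SurjectiveWithoutLargeP) :
    Summit.Langlands.Langlands.Theses.AbelianSurfaceSerre.SerreGSp4Surjective :=
  ⟨0, fun p _ _ ρ h1 h2 => h p ρ h1 h2⟩

end Variants

/-! ## §3b Tightness: the weight class of any witness is forced (NEAR-MISS, paper-true) -/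

/-- **Weight class forced (paper theorem; NOT checkable in the tree today).** For `p ≥ 5` and `ρ̄`
passing (H1), any Galois witness of `Concl` — `r` symplectic with some `ν`, crystalline-ordinary of
strictly increasing shape `a` at `p`, reducing to `ρ̄` — has `a 0 + a 3 = a 1 + a 2` and
`a 0 + a 3 ≡ 1 (mod p - 1)`. Paper proof: ordinary shape ⇒ inertial diagonal `ε^{-aᵢ}`; symplectic
⇒ the multiset `{ε(τ)^{-aᵢ}}` is stable under `x ↦ ν(τ)/x`, and `ε(I_p)` infinite ⇒ pairing is the
reversal, `ν|I_p = ε^{-(a0+a3)}`; full image ⇒ `ν̄ = ε̄⁻¹` (`ρ̄ ≅ ρ̄ ⊗ η ⇒ η = 1` as `ρ̄(ker η) ⊇ Sp₄`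
is absolutely irreducible); `ν ε^{w}` unramified at `p` with trivial reduction ⇒ `p-1 ∣ w-1`.
OBSTRUCTION (what was tried): the tree has no lemma comparing
`GaloisRep.cyclotomicCharacter (v.adicCompletion ℚ) p` on `absInertia` with
`modPCyclotomicCharacterZMod ℚ p ∘ absGaloisRestrict`, and no inertia element with `ε` of infinite
order (both flagged absent in `CrystallineOrdinaryShape.lean`); Brauer–Nesbitt for the multiplier is
also absent. Recorded for the prover: aim at weights `(k₁,k₂) ≡ (2,2) mod (p-1)`, `k₁ ≥ k₂ ≥ 3`
for type-A residuals; never the Calabi–Yau shape `(0,1,2,3)` crystalline. [folklore] -/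
theorem weightClass_forced {p : ℕ} [Fact p.Prime] (hp : 5 ≤ p) {ρ : FramedGaloisRep ℚ (ZMod p) 4}
    (h1 : H1 p ρ) {r : FramedGaloisRep ℚ (PadicAlgCl p) 4} {a : Fin 4 → ℕ} (ha : StrictMono a)
    (hord : ∀ v : HeightOneSpectrum (𝓞 ℚ), ((p : ℕ) : 𝓞 ℚ) ∈ v.asIdeal →
      r.IsCrystallineOrdinaryOfShapeAt v a)
    (hsymp : ∃ ν : Field.absoluteGaloisGroup ℚ → PadicAlgCl p, r.IsSymplecticWithMultiplierFun ν)
    (hred : ∃ red : (Valued.v : Valuation (PadicAlgCl p) NNReal).valuationSubring →+*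
        AlgebraicClosure (ZMod p),
      ∀ g : Field.absoluteGaloisGroup ℚ,
        ∃ P : Polynomial (Valued.v : Valuation (PadicAlgCl p) NNReal).valuationSubring,
          P.map (Valued.v : Valuation (PadicAlgCl p) NNReal).valuationSubring.subtype =
              FramedRep.charpoly r g ∧
            P.map red = (FramedRep.charpoly ρ g).map (algebraMap (ZMod p) (AlgebraicClosure (ZMod p)))) :
    a 0 + a 3 = a 1 + a 2 ∧ (p - 1) ∣ (a 0 + a 3) - 1 := by
  sorry

/-! ## §4 Targets — line `Sketch` (PICKED, now DEAD): kill of v2 stub 3/7 `stub_fontaineVoidBorel` -/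

/-- **The mod-`p` cyclotomic character of a characteristic-`0` field with no non-trivial `p`-th
roots of unity is non-trivial** (infinite Galois theory: a `Γ_K`-fixed element of `K̄` is in `K`).
(Landed copy: `Theorems/SerreGSp4Surjective/Negative/FontaineVoidBorelFalse.lean`, p147593.) [folklore] -/
theorem exists_modPCyclotomicCharacterZMod_ne_one_of (K : Type*) [Field K] [CharZero K]
    (p : ℕ) [Fact p.Prime] [NeZero (p : K)] (hK : ∀ q : K, q ^ p = 1 → q = 1) :
    ∃ g : Field.absoluteGaloisGroup K, modPCyclotomicCharacterZMod K p g ≠ 1 := by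
  by_contra h
  push Not at h
  obtain ⟨ζ, hζ⟩ := HasEnoughRootsOfUnity.exists_primitiveRoot (AlgebraicClosure K) p
  have hfix : ∀ f : AlgebraicClosure K ≃ₐ[K] AlgebraicClosure K, f ζ = ζ := by
    intro f
    have := modPCyclotomicCharacterZMod_spec K p ((Field.absoluteGaloisGroup.toAlgEquiv K).symm f)
      ζ hζ.pow_eq_one
    rw [h _, Field.absoluteGaloisGroup.toAlgEquiv_symm_apply] at this
    have h1 : (((1 : (ZMod p)ˣ) : ZMod p)).val = 1 := by
      rw [Units.val_one, ZMod.val_one]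
    rw [h1, pow_one] at this
    exact this
  obtain ⟨q, hq⟩ := (InfiniteGalois.mem_range_algebraMap_iff_fixed (k := K) ζ).mpr hfix
  have hq1 : q ^ p = 1 := by
    have : (algebraMap K (AlgebraicClosure K)) (q ^ p) = algebraMap K _ 1 := by
      rw [map_pow, hq, hζ.pow_eq_one, map_one]
    exact (algebraMap K (AlgebraicClosure K)).injective this
  have : ζ = 1 := by rw [← hq, hK q hq1, map_one]
  exact hζ.ne_one (Fact.out : p.Prime).one_lt this

/-- Over `ℚ`, `ε̄_p` is non-trivial for every odd prime `p`. [folklore] -/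
theorem exists_modPCyclotomicCharacterZMod_rat_ne_one (p : ℕ) [Fact p.Prime] (hp : p ≠ 2) :
    ∃ g : Field.absoluteGaloisGroup ℚ, modPCyclotomicCharacterZMod ℚ p g ≠ 1 := by
  refine exists_modPCyclotomicCharacterZMod_ne_one_of ℚ p fun q hq => ?_
  have hodd : Odd p := (Fact.out : p.Prime).odd_of_ne_two hp
  exact (hodd.strictMono_pow (R := ℚ)).injective (by simpa using hq)

section Witness

variable (ℓ : ℕ) [Fact ℓ.Prime]

/-- Standard alternating Gram matrix: `Jᵀ = -J`. [folklore] -/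
theorem stdGram_transpose (R : Type*) [CommRing R] :
    (!![0, 0, 0, 1; 0, 0, 1, 0; 0, -1, 0, 0; -1, 0, 0, 0] : Matrix (Fin 4) (Fin 4) R).transpose =
      -!![0, 0, 0, 1; 0, 0, 1, 0; 0, -1, 0, 0; -1, 0, 0, 0] := by
  ext i j; fin_cases i <;> fin_cases j <;> simp

/-- `J² = -1`. [folklore] -/
theorem stdGram_mul_self (R : Type*) [CommRing R] :
    (!![0, 0, 0, 1; 0, 0, 1, 0; 0, -1, 0, 0; -1, 0, 0, 0] : Matrix (Fin 4) (Fin 4) R) *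
        !![0, 0, 0, 1; 0, 0, 1, 0; 0, -1, 0, 0; -1, 0, 0, 0] = -1 := by
  ext i j
  fin_cases i <;> fin_cases j <;> simp [Matrix.mul_apply, Fin.sum_univ_four]

/-- `det J` is a unit. [folklore] -/
theorem isUnit_det_stdGram (R : Type*) [CommRing R] :
    IsUnit (!![0, 0, 0, 1; 0, 0, 1, 0; 0, -1, 0, 0; -1, 0, 0, 0] : Matrix (Fin 4) (Fin 4) R).det := by
  have h : (!![0, 0, 0, 1; 0, 0, 1, 0; 0, -1, 0, 0; -1, 0, 0, 0] : Matrix (Fin 4) (Fin 4) R).det *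
      (!![0, 0, 0, 1; 0, 0, 1, 0; 0, -1, 0, 0; -1, 0, 0, 0] : Matrix (Fin 4) (Fin 4) R).det = 1 := by
    rw [← Matrix.det_mul, stdGram_mul_self, Matrix.det_neg, Matrix.det_one]
    norm_num [Fintype.card_fin]
  exact isUnit_iff_exists_inv.mpr ⟨_, h⟩

/-- `(1 : Γ_ℚ →ₜ* GL₄) g = 1`. [folklore] -/
theorem one_apply_val (g : Field.absoluteGaloisGroup ℚ) :
    ((1 : FramedGaloisRep ℚ (PadicAlgCl ℓ) 4) g).val = 1 := rfl

/-- The trivial representation is symplectic with multiplier `1`. [folklore] -/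
theorem one_isSymplecticWithMultiplierFun :
    (1 : FramedGaloisRep ℚ (PadicAlgCl ℓ) 4).IsSymplecticWithMultiplierFun (fun _ => 1) := by
  refine ⟨_, stdGram_transpose _, isUnit_det_stdGram _, fun g => ?_⟩
  rw [one_apply_val, Matrix.transpose_one, one_mul, mul_one, one_smul]

/-- The trivial representation is unramified everywhere. [folklore] -/
theorem one_isUnramifiedAt (v : HeightOneSpectrum (𝓞 ℚ)) :
    (1 : FramedGaloisRep ℚ (PadicAlgCl ℓ) 4).IsUnramifiedAt v :=
  fun _ _ _ _ => rfl

/-- Its local restriction is locally unramified. [folklore] -/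
theorem one_toLocal_isLocallyUnramified (v : HeightOneSpectrum (𝓞 ℚ)) :
    ((1 : FramedGaloisRep ℚ (PadicAlgCl ℓ) 4).toLocal v).IsLocallyUnramified :=
  fun σ _ => by rw [FramedGaloisRep.toLocal_apply]; rfl

/-- At `v ∣ ℓ`: crystalline (structure axioms) and de Rham with weights in `[0,3]` for THE datum,
unconditionally (`fontainePstAdicCompletion_unramifiedWeightsZero`). [folklore] -/
theorem one_isCrystallineFramed_and_weights (v : HeightOneSpectrum (𝓞 ℚ))
    (hv : ((ℓ : ℕ) : 𝓞 ℚ) ∈ v.asIdeal) :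
    (fontainePstAdicCompletion v ℓ hv).IsCrystallineFramed
        ((1 : FramedGaloisRep ℚ (PadicAlgCl ℓ) 4).toLocal v) ∧
      (fontainePstAdicCompletion v ℓ hv).IsDeRhamWithWeightsIn 0 3
        ((1 : FramedGaloisRep ℚ (PadicAlgCl ℓ) 4).toLocal v) :=
  ⟨PstWeilDeligneData.isCrystallineFramed_of_isLocallyUnramified _
      (one_toLocal_isLocallyUnramified ℓ v),
    (fontainePstAdicCompletion_unramifiedWeightsZero v ℓ hv _
      (one_toLocal_isLocallyUnramified ℓ v)).mono le_rfl (by norm_num)⟩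

/-- `charpoly 1 g = (X - 1)⁴`. [folklore] -/
theorem charpoly_one_eq (g : Field.absoluteGaloisGroup ℚ) :
    FramedRep.charpoly (1 : FramedGaloisRep ℚ (PadicAlgCl ℓ) 4) g = (X - 1) ^ 4 := by
  rw [FramedRep.charpoly, one_apply_val, Matrix.charpoly_one, Fintype.card_fin]

end Witness

/-- VERBATIM copy of skeleton-v2 `Sketch.IsResiduallyCyclotomicBorel` (POSITIVE powers `ε̄ ^ a i` — the
sign defect; v3 uses `ε̄⁻¹ ^ a i`). The line file is a `Cruxes/` workfile and not importable. [folklore] -/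
def IsResiduallyCyclotomicBorelV2 (ℓ : ℕ) [Fact ℓ.Prime] (r : FramedGaloisRep ℚ (PadicAlgCl ℓ) 4)
    (a : Fin 4 → ℕ) : Prop :=
  ∃ red : (Valued.v : Valuation (PadicAlgCl ℓ) NNReal).valuationSubring →+* AlgebraicClosure (ZMod ℓ),
    ∀ g : Field.absoluteGaloisGroup ℚ,
      ∃ P : Polynomial (Valued.v : Valuation (PadicAlgCl ℓ) NNReal).valuationSubring,
        P.map (Valued.v : Valuation (PadicAlgCl ℓ) NNReal).valuationSubring.subtype =
            FramedRep.charpoly r g ∧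
          P.map red = ∏ i : Fin 4,
            (X - C (algebraMap (ZMod ℓ) (AlgebraicClosure (ZMod ℓ))
              (((modPCyclotomicCharacterZMod ℚ ℓ g : (ZMod ℓ)ˣ) : ZMod ℓ) ^ a i)))

/-- VERBATIM copy of skeleton-v2 `Sketch.FontaineVoidBorel` (v2 stub 3/7 was `FontaineVoidBorel 7`;
weights only bounded in `[0,3]`, injective exponents `≤ 3`, positive powers). [folklore] -/
def FontaineVoidBorelV2 (ℓ : ℕ) [Fact ℓ.Prime] : Prop :=
  ∀ r : FramedGaloisRep ℚ (PadicAlgCl ℓ) 4,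
    (∃ ν : Field.absoluteGaloisGroup ℚ → PadicAlgCl ℓ, r.IsSymplecticWithMultiplierFun ν) →
    (∀ v : HeightOneSpectrum (𝓞 ℚ), ((ℓ : ℕ) : 𝓞 ℚ) ∉ v.asIdeal → r.IsUnramifiedAt v) →
    (∀ (v : HeightOneSpectrum (𝓞 ℚ)) (hv : ((ℓ : ℕ) : 𝓞 ℚ) ∈ v.asIdeal),
      (fontainePstAdicCompletion v ℓ hv).IsCrystallineFramed (r.toLocal v) ∧
        (fontainePstAdicCompletion v ℓ hv).IsDeRhamWithWeightsIn 0 3 (r.toLocal v)) →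
    ∃ a : Fin 4 → ℕ, Function.Injective a ∧ (∀ i, a i ≤ 3) ∧ IsResiduallyCyclotomicBorelV2 ℓ r a ∧
      ∀ v : HeightOneSpectrum (𝓞 ℚ), ((ℓ : ℕ) : 𝓞 ℚ) ∈ v.asIdeal →
        r.IsCrystallineOrdinaryOfShapeAt v ![0, 1, 2, 3]

/-- **TARGET KILLED — v2 `stub_fontaineVoidBorel` (`FontaineVoidBorelV2 ℓ`) is false for every odd
`ℓ`**, in particular at the line's `ℓ = 7` and at ideator-1's `ℓ = 5`. Witness `r = 1`. Landed as
`Theorems/SerreGSp4Surjective/Negative/FontaineVoidBorelFalse.lean` (p147593; statement inlined there,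
identical to v2 `Sketch.FontaineVoidBorel ℓ` modulo unfolding — textually diffed). [folklore] -/
theorem stub_fontaineVoidBorelV2_false (ℓ : ℕ) [Fact ℓ.Prime] (hℓ : ℓ ≠ 2) :
    ¬ FontaineVoidBorelV2 ℓ := by
  intro h
  obtain ⟨a, ha_inj, ha_le, ⟨red, hred⟩, -⟩ :=
    h 1 ⟨_, one_isSymplecticWithMultiplierFun ℓ⟩ (fun v _ => one_isUnramifiedAt ℓ v)
      (one_isCrystallineFramed_and_weights ℓ)
  obtain ⟨g, hg⟩ := exists_modPCyclotomicCharacterZMod_rat_ne_one ℓ hℓ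
  obtain ⟨P, hP1, hP2⟩ := hred g
  have hP : P = (X - 1) ^ 4 := by
    apply Polynomial.map_injective (Valued.v : Valuation (PadicAlgCl ℓ) NNReal).valuationSubring.subtype
      Subtype.val_injective
    rw [hP1, charpoly_one_eq]
    simp [Polynomial.map_sub, Polynomial.map_pow]
  rw [hP] at hP2
  have hlhs : ((X - 1 :
      Polynomial (Valued.v : Valuation (PadicAlgCl ℓ) NNReal).valuationSubring) ^ 4).map red =
      (X - 1) ^ 4 := by
    simp [Polynomial.map_sub, Polynomial.map_pow]
  obtain ⟨i, hi⟩ : ∃ i, a i = 1 := by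
    have hinj : Function.Injective
        (fun i : Fin 4 => (⟨a i, Nat.lt_succ_of_le (ha_le i)⟩ : Fin 4)) := by
      intro i j hij
      exact ha_inj (by simpa using congrArg Fin.val hij)
    have hsurj : Function.Surjective _ := Finite.injective_iff_surjective.mp hinj
    obtain ⟨i, hi⟩ := hsurj 1
    exact ⟨i, by simpa using congrArg Fin.val hi⟩
  set c : AlgebraicClosure (ZMod ℓ) := algebraMap (ZMod ℓ) (AlgebraicClosure (ZMod ℓ))
    (((modPCyclotomicCharacterZMod ℚ ℓ g : (ZMod ℓ)ˣ) : ZMod ℓ)) with hc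
  have hroot : ((X - 1 : (AlgebraicClosure (ZMod ℓ))[X]) ^ 4).eval c = 0 := by
    rw [← hlhs, hP2, Polynomial.eval_prod]
    exact Finset.prod_eq_zero (Finset.mem_univ i) (by simp [hi, hc])
  have hc1 : c = 1 := by
    simpa [sub_eq_zero] using hroot
  apply hg
  ext
  rw [Units.val_one]
  exact (algebraMap (ZMod ℓ) (AlgebraicClosure (ZMod ℓ))).injective (by rw [map_one]; exact hc1)

/-- **Consequence for skeleton v2**: with the void engine false, v2 stub 5/7 (`stub_levelOne_of`,
hypotheses `CoxeterOrderArith`, `FontaineVoidBorel 7`, `BorelSkinnerWilesGSp4 7`) is provable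
VACUOUSLY — for ANY conclusion. (v3 re-typed the engine; the line was then declared dead for the
independent reason D1 of `Sketch-dead.md`.) [folklore] -/
theorem levelOne_decomposition_vacuous_v2 (ℓ : ℕ) [Fact ℓ.Prime] (hℓ : ℓ ≠ 2) (C : Prop)
    (hvoid : FontaineVoidBorelV2 ℓ) : C :=
  (stub_fontaineVoidBorelV2_false ℓ hℓ hvoid).elim

end

end Summit.Langlands.Langlands.Cruxes.SerreGSp4Surjective.Disproof
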